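import Summits.ValiantsHypothesis.ValiantsHypothesis.Theorems.GrenetZeonDualUnipotentThreeHalvesSlowCoreLedger

/-!
# RESOLVENT FLAGS for crux 24318 (c) `LongMassSlowLawInv` / HWL — providers, (rev 2) their PROOF, (rev 3) the EXACT dictionary

val-idea-30 g6 (signatures, dictionary) · g7 (§P: kernel proof of both providers; §Q: `Ledger ⟺ one congruence`, exact).  Crux workfile of the idea
`Ideas/resolvent-flag.md` (memo `MEMO-idea30-g6-resolvent-flag.md`), stated over the landed Theorems twins
✓ `SlowCore.Ledger` / `SlowCore.linEntry` / `SlowCore.RelCert` (file `…SlowCoreLedger.lean`).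
VP ≠ VNP is NOT proved; 24318 / S3 / R2ᵖ / (c) are OPEN.  What IS proved here (rev 2, 0 sorries, axioms standard):
`ledgerOfResolventIndex_holds : LedgerOfResolventIndex`, `ledgerOfResolventFlag_holds : LedgerOfResolventFlag`,
and the pluggable form `relCert_of_twist_pow_eq_zero` (a resolvent-index certificate `(K, k)` is a `RelCert` of price
`n·k + codim K`) — i.e. every resolvent-flag / resolvent-index computation of the (c)-programme is a kernel `Ledger`.
REV 3 (§Q, 0 sorries): the identity `[s^d](A+sB)^b = [u^{b-d}](T^d R_A)` for ALL `b, d` with NO hypothesis on the twist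
(`pow_lineSubst_apply_eq_sum`, `coeff_pow_lineSubst_apply`), hence the EXACT instrument
`ledger_top_iff_twist_pow_congr : Ledger n m N ⊤ K k ↔ ∀ x, ∀ v ∈ K, (twist N x v)^(k+1) ≡ 0 mod u^(n-1-k)` (coefficientwise),
and the congruence certificate `relCert_of_twist_pow_congr` (strictly more certificates than exact vanishing when `(k+1)(m-1) > n-2-k`).

Dictionary (memo §1): with `A := N(x)`, `B_v := lin v`, `R_A(u) := Σ_{a<m} u^a A^a = (1 - uA)⁻¹` (A^m = 0),
  `Σ_j u^j (A + sB)^j = Σ_d (us)^d (R_A B)^d R_A`,  so  `[s^d](A+sB)^j = [u^{j-d}] (R_A B)^d R_A`,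
hence `Ledger_n(K,k)` at `x`  ⟺  `∀ v ∈ K, (R_A(u) B_v)^{k+1} ≡ 0 mod u^{n-1-k}`; in particular the EXACT identity
`(R_A(u) B_v)^{k+1} = 0` in `M_m(ℂ[u])` gives the ledger for every `n` (provider `LedgerOfResolventIndex`, ✓ §P), and an
`F(u)`-flag lowered by the twisted space `R_A(u)·lin K` (all `(k+1)`-fold products vanish) gives it a fortiori
(provider `LedgerOfResolventFlag`, ✓ §P).  The proof in §P is a finite polynomial identity over `ℂ[s][u]`
(`1 − u(A+sB) = (1 − uA)(1 − us·R_A B)` + two geometric sums + comparison of `u^b`-coefficients); no power series.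
-/

set_option linter.dupNamespace false

namespace Summit.ValiantsHypothesis.ValiantsHypothesis.Cruxes.DualUnipotentThreeHalves.ResolventFlag

open MvPolynomial Matrix
open scoped BigOperators Polynomial
open Summit.ValiantsHypothesis.ValiantsHypothesis.Cruxes.TwoDimCoefficients.DimTwoCases (AffMat IsAffine)
open Summit.ValiantsHypothesis.ValiantsHypothesis.Theorems.GrenetZeon.SlowCore (linEntry Ledger RelCert)

/-- The value `N(x) ∈ M_m(ℂ)` of the pencil at the point `x`. -/
noncomputable def pointMat {n m : ℕ} (N : AffMat n m) (x : Fin n × Fin n → ℂ) : Matrix (Fin m) (Fin m) ℂ :=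
  N.map (MvPolynomial.eval x)

/-- The linear part of the pencil along the direction `v`: `(lin v)_{ij} = linEntry N i j v`. -/
noncomputable def linMat {n m : ℕ} (N : AffMat n m) (v : Fin n × Fin n → ℂ) : Matrix (Fin m) (Fin m) ℂ :=
  Matrix.of fun i j => linEntry N i j v

/-- The (truncated) RESOLVENT `R_A(u) = Σ_{a<m} u^a A^a ∈ M_m(ℂ[u])` of `A = N(x)`; equals `(1 - u A)⁻¹` when `A^m = 0`. -/
noncomputable def resolvent {n m : ℕ} (N : AffMat n m) (x : Fin n × Fin n → ℂ) : Matrix (Fin m) (Fin m) ℂ[X] :=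
  ∑ a ∈ Finset.range m, (Polynomial.X : ℂ[X]) ^ a • ((pointMat N x) ^ a).map Polynomial.C

/-- The TWIST of the direction `v` at the point `x`: `R_{N(x)}(u) · lin v ∈ M_m(ℂ[u])`. -/
noncomputable def twist {n m : ℕ} (N : AffMat n m) (x v : Fin n × Fin n → ℂ) : Matrix (Fin m) (Fin m) ℂ[X] :=
  resolvent N x * (linMat N v).map Polynomial.C

/-- **FIRST LEMMA (provider, index form).**  If at every point `x` every twisted direction `R_{N(x)}(u)·lin v` (`v ∈ K`) is
nilpotent of index `≤ k+1` as a matrix over `ℂ[u]`, then `(K, k)` is a whole-pencil ledger of `N` for EVERY `n`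
(no truncation loss).  Paper proof: the resolvent identity `[s^d](A+sB)^b = [u^{b-d}](R_A B)^d R_A`. -/
def LedgerOfResolventIndex : Prop :=
  ∀ (n m : ℕ) (N : AffMat n m), IsAffine N → N ^ m = 0 →
    ∀ (K : Submodule ℂ (Fin n × Fin n → ℂ)) (k : ℕ),
      (∀ x v : Fin n × Fin n → ℂ, v ∈ K → (twist N x v) ^ (k + 1) = 0) →
        Ledger n m N (fun _ => True) K k

/-- **FIRST LEMMA (provider, flag form = RESOLVENT FLAG).**  If at every point `x` all `(k+1)`-fold products of twisted
directions vanish — equivalently the twisted space `R_{N(x)}(u)·lin K` lowers a chain of `ℂ(u)`-subspaces of length `k+1` —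
then `(K, k)` is a whole-pencil ledger for every `n`.  (Gauge row r4 on the cones `W(m)` is the half-twisted flag
`E_{>h} < R_A(u)E_{≥h} < ℂ(u)^m`, memo §3; flag floor r4′ concerns CONSTANT flags only.) -/
def LedgerOfResolventFlag : Prop :=
  ∀ (n m : ℕ) (N : AffMat n m), IsAffine N → N ^ m = 0 →
    ∀ (K : Submodule ℂ (Fin n × Fin n → ℂ)) (k : ℕ),
      (∀ x : Fin n × Fin n → ℂ, ∀ w : Fin (k + 1) → (Fin n × Fin n → ℂ), (∀ t, w t ∈ K) →
          (List.ofFn fun t => twist N x (w t)).prod = 0) →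
        Ledger n m N (fun _ => True) K k

/-- The flag form implies the index form's hypothesis (constant words), so it is the weaker provider. -/
theorem resolventFlag_hyp_of_const {n m : ℕ} (N : AffMat n m) (K : Submodule ℂ (Fin n × Fin n → ℂ)) (k : ℕ)
    (h : ∀ x : Fin n × Fin n → ℂ, ∀ w : Fin (k + 1) → (Fin n × Fin n → ℂ), (∀ t, w t ∈ K) →
      (List.ofFn fun t => twist N x (w t)).prod = 0)
    (x v : Fin n × Fin n → ℂ) (hv : v ∈ K) : (twist N x v) ^ (k + 1) = 0 := by
  have := h x (fun _ => v) (fun _ => hv)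
  rw [pow_succ']
  simpa [List.ofFn_const, List.prod_replicate] using this

theorem ledgerOfResolventFlag_of_index (h : LedgerOfResolventIndex) : LedgerOfResolventFlag := by
  intro n m N hN hnil K k hw
  exact h n m N hN hnil K k (fun x v hv => resolventFlag_hyp_of_const N K k hw x v hv)

/-! ## §P (val-idea-30 g7) PROOF of the index provider `LedgerOfResolventIndex` — hence of `LedgerOfResolventFlag`

Finite polynomial-identity proof (no power series).  Over the `u`-polynomial ring `S[X]`, `S := MvPolynomial (Fin 1) ℂ`
(the `s`-ring, `s = X 0`), with `A := N(x)`, `B := lin v`, `M := N(x + s v) = A + s·B`, `R_A := Σ_{a<m} u^a A^a`, `T := R_A·B`,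
`σ := s` (a constant of `S[X]`):
* `(1 − uA)·R_A = 1` (geometric sum, `A^m = 0`);
* `T^{k+1} = 0 ⇒ (1 − σu·T)·G = 1` with `G := Σ_{d ≤ k} (σu·T)^d`;
* `1 − u·M = (1 − uA)(1 − σu·T)`, hence `(1 − uM)·(G·R_A) = 1`;
* `Σ_{j ≤ b} (uM)^j = G·R_A − (uM)^{b+1}·G·R_A` (geometric sum), and comparing the coefficients of `u^b` entrywise:
  `(M^b)_{ij} = Σ_{d ≤ k, d ≤ b} s^d · [u^{b−d}] (T^d R_A)_{ij}` — an `s`-polynomial of degree `≤ k`, for EVERY exponent `b`.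
-/

section Proof

open Polynomial (coeff)
open Summit.ValiantsHypothesis.ValiantsHypothesis.Theorems.GrenetZeon.RadicalSplit (lineSubst)
open Summit.ValiantsHypothesis.ValiantsHypothesis.Theorems.GrenetZeon.SlowCore (lineSubst_apply_of_le_one)

variable {n m : ℕ}

/-- The `s`-ring `ℂ[s]` of the ledger (`s = MvPolynomial.X 0`). -/
private abbrev SRing : Type := MvPolynomial (Fin 1) ℂ

/-- Transport `ℂ[u] → ℂ[s][u]` on matrices (coefficientwise `MvPolynomial.C`). -/
private noncomputable def transport (m : ℕ) :
    Matrix (Fin m) (Fin m) ℂ[X] →+* Matrix (Fin m) (Fin m) (Polynomial SRing) :=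
  (Polynomial.mapRingHom (MvPolynomial.C : ℂ →+* SRing)).mapMatrix

/-- A complex matrix as a matrix of constants of `ℂ[s][u]`. -/
private noncomputable def cst (P : Matrix (Fin m) (Fin m) ℂ) : Matrix (Fin m) (Fin m) (Polynomial SRing) :=
  P.map fun a => Polynomial.C (MvPolynomial.C a : SRing)

private theorem transport_apply (Q : Matrix (Fin m) (Fin m) ℂ[X]) (i j : Fin m) :
    transport m Q i j = Polynomial.map (MvPolynomial.C : ℂ →+* SRing) (Q i j) := by
  simp [transport, RingHom.mapMatrix_apply, Matrix.map_apply]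

private theorem transport_map_C (P : Matrix (Fin m) (Fin m) ℂ) :
    transport m (P.map Polynomial.C) = cst P := by
  refine Matrix.ext fun i j => ?_
  rw [transport_apply, Matrix.map_apply, Polynomial.map_C, cst, Matrix.map_apply]

private theorem transport_X_pow_smul (a : ℕ) (Q : Matrix (Fin m) (Fin m) ℂ[X]) :
    transport m ((Polynomial.X : ℂ[X]) ^ a • Q) = (Polynomial.X : Polynomial SRing) ^ a • transport m Q := by
  refine Matrix.ext fun i j => ?_
  rw [transport_apply, Matrix.smul_apply, Matrix.smul_apply, smul_eq_mul, smul_eq_mul, Polynomial.map_mul,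
    Polynomial.map_pow, Polynomial.map_X, transport_apply]

/-- `A^m = 0` for the point value `A = N(x)` of a pencil with `N^m = 0`. -/
private theorem pointMat_pow_eq_zero (N : AffMat n m) (hnil : N ^ m = 0) (x : Fin n × Fin n → ℂ) :
    (pointMat N x) ^ m = 0 := by
  rw [pointMat, ← Matrix.map_pow N (MvPolynomial.eval x : MvPolynomial (Fin n × Fin n) ℂ →+* ℂ) m]
  change (N ^ m).map (MvPolynomial.eval x) = 0
  simp [hnil]

/-- The resolvent is a geometric sum: `R_A = Σ_{a<m} (u·A)^a`. -/
private theorem resolvent_eq_geom_sum (N : AffMat n m) (x : Fin n × Fin n → ℂ) :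
    resolvent N x = ∑ a ∈ Finset.range m, ((Polynomial.X : ℂ[X]) • (pointMat N x).map Polynomial.C) ^ a := by
  refine Finset.sum_congr rfl fun a _ => ?_
  rw [smul_pow, Matrix.map_pow (pointMat N x) (Polynomial.C : ℂ →+* ℂ[X]) a]

/-- `(1 − u·A)·R_A = 1` over `ℂ[u]`. -/
private theorem one_sub_smul_mul_resolvent (N : AffMat n m) (hnil : N ^ m = 0) (x : Fin n × Fin n → ℂ) :
    (1 - (Polynomial.X : ℂ[X]) • (pointMat N x).map Polynomial.C) * resolvent N x = 1 := by
  rw [resolvent_eq_geom_sum, mul_neg_geom_sum, smul_pow,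
    ← Matrix.map_pow (pointMat N x) (Polynomial.C : ℂ →+* ℂ[X]) m]
  change 1 - (Polynomial.X : ℂ[X]) ^ m • ((pointMat N x) ^ m).map Polynomial.C = 1
  rw [pointMat_pow_eq_zero N hnil x]
  ext i j
  simp

/-- The substituted pencil as a `u`-constant: `M = A + σ·B` with `σ = s`. -/
private theorem map_lineSubst_map_C (N : AffMat n m) (hN : IsAffine N) (x v : Fin n × Fin n → ℂ) :
    (N.map (lineSubst x v)).map (Polynomial.C : SRing → Polynomial SRing) =
      cst (pointMat N x) + Polynomial.C (MvPolynomial.X 0 : SRing) • cst (linMat N v) := by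
  refine Matrix.ext fun i j => ?_
  rw [Matrix.map_apply, Matrix.map_apply, lineSubst_apply_of_le_one N hN x v i j, Matrix.add_apply,
    Matrix.smul_apply, smul_eq_mul, cst, cst, Matrix.map_apply, Matrix.map_apply, pointMat, linMat,
    Matrix.map_apply, Matrix.of_apply, Polynomial.C_add, Polynomial.C_mul, mul_comm]

/-- `transport` commutes with the scalar `u`. -/
private theorem transport_X_smul (Q : Matrix (Fin m) (Fin m) ℂ[X]) :
    transport m ((Polynomial.X : ℂ[X]) • Q) = (Polynomial.X : Polynomial SRing) • transport m Q := by
  simpa only [pow_one] using transport_X_pow_smul 1 Q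

/-- **MAIN LEMMA.**  If the twisted direction `R_{N(x)}(u)·lin v` is nilpotent of index `≤ k+1` over `ℂ[u]`, then EVERY power of
`N(x + s v)` has entries of `s`-degree `≤ k` (all exponents `b`, no truncation). -/
theorem totalDegree_pow_apply_le_of_twist_pow_eq_zero (N : AffMat n m) (hN : IsAffine N) (hnil : N ^ m = 0)
    (x v : Fin n × Fin n → ℂ) (k : ℕ) (hT : (twist N x v) ^ (k + 1) = 0) (b : ℕ) (i j : Fin m) :
    (((N.map (lineSubst x v)) ^ b) i j).totalDegree ≤ k := by
  classical
  -- everything is cast into matrices over `S[u]`, `S = ℂ[s]`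
  set M : Matrix (Fin m) (Fin m) SRing := N.map (lineSubst x v) with hM
  set Mu : Matrix (Fin m) (Fin m) (Polynomial SRing) := M.map Polynomial.C with hMu
  set Au : Matrix (Fin m) (Fin m) (Polynomial SRing) := cst (pointMat N x) with hAu
  set Bu : Matrix (Fin m) (Fin m) (Polynomial SRing) := cst (linMat N v) with hBu
  set RA : Matrix (Fin m) (Fin m) (Polynomial SRing) := transport m (resolvent N x) with hRA
  set T : Matrix (Fin m) (Fin m) (Polynomial SRing) := transport m (twist N x v) with hTdef
  set u : Polynomial SRing := Polynomial.X with hu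
  set σ : Polynomial SRing := Polynomial.C (MvPolynomial.X 0 : SRing) with hσ
  -- (1) `(1 − uA) R_A = 1`
  have h1 : (1 - u • Au) * RA = 1 := by
    have h0 := congrArg (transport m) (one_sub_smul_mul_resolvent N hnil x)
    rw [map_mul, map_one, map_sub, map_one, transport_X_smul, transport_map_C, ← hu, ← hAu, ← hRA] at h0
    exact h0
  -- (2) `T = R_A · B`, `T^{k+1} = 0`
  have hT' : T = RA * Bu := by
    rw [hTdef, twist, map_mul, transport_map_C, ← hRA, ← hBu]
  have hTk : T ^ (k + 1) = 0 := by
    rw [hTdef, ← map_pow, hT, map_zero]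
  -- (3) `(1 − σu·T) G = 1`
  set G : Matrix (Fin m) (Fin m) (Polynomial SRing) := ∑ d ∈ Finset.range (k + 1), ((σ * u) • T) ^ d with hG
  have h3 : (1 - (σ * u) • T) * G = 1 := by
    rw [hG, mul_neg_geom_sum, smul_pow, hTk, smul_zero, sub_zero]
  -- (4) `M = A + σ B` and `1 − uM = (1 − uA)(1 − σu T)`, so `(1 − uM)(G R_A) = 1`
  have hMu' : Mu = Au + σ • Bu := by
    rw [hMu, hM, hAu, hBu, hσ]
    exact map_lineSubst_map_C N hN x v
  have h4 : 1 - u • Mu = (1 - u • Au) * (1 - (σ * u) • T) := by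
    rw [mul_sub, mul_one, Matrix.mul_smul, hT', ← Matrix.mul_assoc, h1, Matrix.one_mul, hMu', smul_add,
      ← mul_smul, mul_comm u σ]
    abel
  have h5 : (1 - u • Mu) * (G * RA) = 1 := by
    rw [h4, Matrix.mul_assoc, ← Matrix.mul_assoc _ G RA, h3, Matrix.one_mul, h1]
  -- (5) geometric sum for `uM`
  have h6 : (∑ a ∈ Finset.range (b + 1), (u • Mu) ^ a) = G * RA - (u • Mu) ^ (b + 1) * (G * RA) := by
    have hgs : (∑ a ∈ Finset.range (b + 1), (u • Mu) ^ a) * (1 - u • Mu) = 1 - (u • Mu) ^ (b + 1) :=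
      geom_sum_mul_neg _ _
    calc (∑ a ∈ Finset.range (b + 1), (u • Mu) ^ a)
        = (∑ a ∈ Finset.range (b + 1), (u • Mu) ^ a) * ((1 - u • Mu) * (G * RA)) := by
          rw [h5, Matrix.mul_one]
      _ = (1 - (u • Mu) ^ (b + 1)) * (G * RA) := by rw [← Matrix.mul_assoc, hgs]
      _ = G * RA - (u • Mu) ^ (b + 1) * (G * RA) := by rw [sub_mul, Matrix.one_mul]
  -- (6) compare the `u^b` coefficients of the `(i,j)` entries
  have hcoef : coeff ((∑ a ∈ Finset.range (b + 1), (u • Mu) ^ a) i j) b =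
      coeff ((G * RA - (u • Mu) ^ (b + 1) * (G * RA)) i j) b := by
    rw [h6]
  -- left side = `(M^b) i j`
  have hterm : ∀ a : ℕ, coeff (((u • Mu) ^ a) i j) b = if b = a then (M ^ a) i j else 0 := by
    intro a
    rw [smul_pow, Matrix.smul_apply, smul_eq_mul, hMu, ← Matrix.map_pow M (Polynomial.C : SRing →+* _) a]
    change coeff (u ^ a * Polynomial.C ((M ^ a) i j)) b = _
    rw [mul_comm, hu, Polynomial.coeff_C_mul_X_pow]
  have hL : coeff ((∑ a ∈ Finset.range (b + 1), (u • Mu) ^ a) i j) b = (M ^ b) i j := by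
    rw [Matrix.sum_apply, Polynomial.finsetSum_coeff,
      Finset.sum_eq_single_of_mem b (Finset.mem_range.2 (Nat.lt_succ_self b))
        (fun a _ hab => by rw [hterm a, if_neg (Ne.symm hab)]),
      hterm b, if_pos rfl]
  -- the tail term has no `u^b` coefficient
  have hR2 : coeff (((u • Mu) ^ (b + 1) * (G * RA)) i j) b = 0 := by
    rw [smul_pow, Matrix.smul_mul, Matrix.smul_apply, smul_eq_mul, hu, Polynomial.coeff_X_pow_mul',
      if_neg (by omega)]
  -- the head term is an `s`-polynomial of degree `≤ k`
  have hR1 : coeff ((G * RA) i j) b = ∑ d ∈ Finset.range (k + 1),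
      (if d ≤ b then (MvPolynomial.X 0 : SRing) ^ d *
        MvPolynomial.C (coeff (((twist N x v) ^ d * resolvent N x) i j) (b - d)) else 0) := by
    rw [hG, Finset.sum_mul, Matrix.sum_apply, Polynomial.finsetSum_coeff]
    refine Finset.sum_congr rfl fun d _ => ?_
    rw [smul_pow, Matrix.smul_mul, Matrix.smul_apply, smul_eq_mul, hTdef, hRA, ← map_pow, ← map_mul,
      transport_apply, mul_pow, hσ, ← Polynomial.C_pow, mul_assoc, Polynomial.coeff_C_mul, hu,
      Polynomial.coeff_X_pow_mul']
    by_cases hdb : d ≤ b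
    · rw [if_pos hdb, if_pos hdb, Polynomial.coeff_map]
    · rw [if_neg hdb, if_neg hdb, mul_zero]
  rw [hL, Matrix.sub_apply, Polynomial.coeff_sub, hR2, sub_zero, hR1] at hcoef
  rw [hcoef]
  refine (MvPolynomial.totalDegree_finsetSum _ _).trans (Finset.sup_le fun d hd => ?_)
  have hdk : d ≤ k := Nat.lt_succ_iff.1 (Finset.mem_range.1 hd)
  by_cases hdb : d ≤ b
  · rw [if_pos hdb]
    refine (MvPolynomial.totalDegree_mul _ _).trans ?_
    rw [MvPolynomial.totalDegree_C, add_zero]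
    exact (MvPolynomial.totalDegree_X_pow (R := ℂ) (0 : Fin 1) d).le.trans hdk
  · rw [if_neg hdb, MvPolynomial.totalDegree_zero]
    exact Nat.zero_le _

/-- ✓ **The index provider HOLDS**: twisted directions of nil-index `≤ k+1` over `ℂ[u]` give the whole-pencil ledger `(K, k)` for every `n`. -/
theorem ledgerOfResolventIndex_holds : LedgerOfResolventIndex := by
  intro n m N hN hnil K k hK x v hv b _ i j _ _
  exact totalDegree_pow_apply_le_of_twist_pow_eq_zero N hN hnil x v k (hK x v hv) b i j

/-- ✓ **The flag provider HOLDS** (resolvent flags of length `k+1` certify the ledger `(K, k)` for every `n`). -/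
theorem ledgerOfResolventFlag_holds : LedgerOfResolventFlag :=
  ledgerOfResolventFlag_of_index ledgerOfResolventIndex_holds

/-- ✓ **Pluggable form for (c)**: a resolvent-index certificate `(K, k)` — every twisted direction `R_{N(x)}(u)·lin v`, `v ∈ K`,
nilpotent of index `≤ k+1` over `ℂ[u]` — is a whole-pencil `RelCert` of PRICE `n·k + codim K` (for every `n`). -/
theorem relCert_of_twist_pow_eq_zero {n m : ℕ} (N : AffMat n m) (hN : IsAffine N) (hnil : N ^ m = 0)
    (K : Submodule ℂ (Fin n × Fin n → ℂ)) (k : ℕ)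
    (hK : ∀ x v : Fin n × Fin n → ℂ, v ∈ K → (twist N x v) ^ (k + 1) = 0) :
    RelCert n m N (n * k + (n * n - Module.finrank ℂ K)) :=
  ⟨K, k, ledgerOfResolventIndex_holds n m N hN hnil K k hK, le_rfl⟩

/-! ## §Q (val-idea-30 g7, rev 3) The EXACT dictionary in kernel: `[s^d](A+sB)^b = [u^{b−d}](T^d·R_A)` for ALL `b, d`, and `Ledger ⟺ ONE CONGRUENCE` (memo (D2); crit-7 V36 (D))

No hypothesis on the twist is needed for the identity: with `G_b := Σ_{d ≤ b} (σu·T)^d` one has `(1 − σuT)·G_b = 1 − E`,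
`E := (σu·T)^{b+1}`, so `(1 − uM)(G_b R_A) = 1 − E'` with `E' := (1 − uA)·E·R_A`, and
`Σ_{a ≤ b}(uM)^a = G_b R_A − (uM)^{b+1} G_b R_A + (Σ_{a≤b}(uM)^a)·E'`; both error terms are multiples of `u^{b+1}`, whence
`(M^b)_{ij} = Σ_{d ≤ b} s^d · [u^{b−d}](T^d R_A)_{ij}` EXACTLY (`pow_lineSubst_apply_eq_sum`, `coeff_pow_lineSubst_apply`).  Consequence:
  `Ledger n m N ⊤ K k  ⟺  ∀ x, ∀ v ∈ K: (R_{N(x)}(u)·lin v)^{k+1} ≡ 0 mod u^{n−1−k}`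
(`ledger_top_iff_twist_pow_congr`; coefficientwise: `coeff_e ((twist N x v)^(k+1))_{ij} = 0` whenever `e + k + 2 ≤ n`), and the sharper
certificate form `relCert_of_twist_pow_congr` (a congruence instead of exact vanishing; strictly more certificates once `(k+1)(m−1) > n−2−k`).
So the instrument is EXACT: a whole-pencil ledger `(K, k)` is ONE matrix congruence of degree `k+1` in `v` per point `x`, nothing more, nothing less.
-/

/-- `R_A·(1 − u·A) = 1` over `ℂ[u]` (right-inverse form of `one_sub_smul_mul_resolvent`). -/
private theorem resolvent_mul_one_sub_smul (N : AffMat n m) (hnil : N ^ m = 0) (x : Fin n × Fin n → ℂ) :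
    resolvent N x * (1 - (Polynomial.X : ℂ[X]) • (pointMat N x).map Polynomial.C) = 1 := by
  rw [resolvent_eq_geom_sum, geom_sum_mul_neg, smul_pow,
    ← Matrix.map_pow (pointMat N x) (Polynomial.C : ℂ →+* ℂ[X]) m]
  change 1 - (Polynomial.X : ℂ[X]) ^ m • ((pointMat N x) ^ m).map Polynomial.C = 1
  rw [pointMat_pow_eq_zero N hnil x]
  ext i j
  simp

/-- **EXACT DICTIONARY (universal identity; no hypothesis on the twist).**  For EVERY exponent `b` and entry `(i,j)`:
`(N(x+sv)^b)_{ij} = Σ_{d ≤ b} s^d · C([u^{b−d}] (T^d · R_A)_{ij})` with `T = twist N x v = R_{N(x)}(u)·lin v`, `R_A = resolvent N x` —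
i.e. `[s^d](A+sB)^b = [u^{b−d}](T^d R_A)` (memo (D1), Kato's second Neumann series read coefficientwise, here as a finite identity). -/
theorem pow_lineSubst_apply_eq_sum (N : AffMat n m) (hN : IsAffine N) (hnil : N ^ m = 0)
    (x v : Fin n × Fin n → ℂ) (b : ℕ) (i j : Fin m) :
    ((N.map (lineSubst x v)) ^ b) i j =
      ∑ d ∈ Finset.range (b + 1), (MvPolynomial.X 0 : MvPolynomial (Fin 1) ℂ) ^ d *
        MvPolynomial.C (coeff (((twist N x v) ^ d * resolvent N x) i j) (b - d)) := by
  classical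
  set M : Matrix (Fin m) (Fin m) SRing := N.map (lineSubst x v) with hM
  set Mu : Matrix (Fin m) (Fin m) (Polynomial SRing) := M.map Polynomial.C with hMu
  set Au : Matrix (Fin m) (Fin m) (Polynomial SRing) := cst (pointMat N x) with hAu
  set Bu : Matrix (Fin m) (Fin m) (Polynomial SRing) := cst (linMat N v) with hBu
  set RA : Matrix (Fin m) (Fin m) (Polynomial SRing) := transport m (resolvent N x) with hRA
  set T : Matrix (Fin m) (Fin m) (Polynomial SRing) := transport m (twist N x v) with hTdef
  set u : Polynomial SRing := Polynomial.X with hu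
  set σ : Polynomial SRing := Polynomial.C (MvPolynomial.X 0 : SRing) with hσ
  -- (1) `(1 − uA) R_A = 1`
  have h1 : (1 - u • Au) * RA = 1 := by
    have h0 := congrArg (transport m) (one_sub_smul_mul_resolvent N hnil x)
    rw [map_mul, map_one, map_sub, map_one, transport_X_smul, transport_map_C, ← hu, ← hAu, ← hRA] at h0
    exact h0
  -- (2) `T = R_A · B`
  have hT' : T = RA * Bu := by
    rw [hTdef, twist, map_mul, transport_map_C, ← hRA, ← hBu]
  -- (3') truncated geometric sum `(1 − σu·T) G = 1 − E`
  set G : Matrix (Fin m) (Fin m) (Polynomial SRing) := ∑ d ∈ Finset.range (b + 1), ((σ * u) • T) ^ d with hG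
  set E : Matrix (Fin m) (Fin m) (Polynomial SRing) := ((σ * u) • T) ^ (b + 1) with hE
  have h3 : (1 - (σ * u) • T) * G = 1 - E := by
    rw [hG, hE, mul_neg_geom_sum]
  -- (4') `M = A + σ B`, `1 − uM = (1 − uA)(1 − σu T)`, `(1 − uM)(G R_A) = 1 − E'`
  have hMu' : Mu = Au + σ • Bu := by
    rw [hMu, hM, hAu, hBu, hσ]
    exact map_lineSubst_map_C N hN x v
  have h4 : 1 - u • Mu = (1 - u • Au) * (1 - (σ * u) • T) := by
    rw [mul_sub, mul_one, Matrix.mul_smul, hT', ← Matrix.mul_assoc, h1, Matrix.one_mul, hMu', smul_add,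
      ← mul_smul, mul_comm u σ]
    abel
  set E' : Matrix (Fin m) (Fin m) (Polynomial SRing) := (1 - u • Au) * (E * RA) with hE'
  have h5 : (1 - u • Mu) * (G * RA) = 1 - E' := by
    have h35 : (1 - (σ * u) • T) * (G * RA) = RA - E * RA := by
      rw [← Matrix.mul_assoc, h3, sub_mul 1 E RA, Matrix.one_mul]
    rw [h4, Matrix.mul_assoc, h35, mul_sub (1 - u • Au) RA (E * RA), h1]
  -- (5') geometric sum for `uM`, with the error term `S·E'`
  set S : Matrix (Fin m) (Fin m) (Polynomial SRing) := ∑ a ∈ Finset.range (b + 1), (u • Mu) ^ a with hS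
  have hgs : S * (1 - u • Mu) = 1 - (u • Mu) ^ (b + 1) := by
    rw [hS]
    exact geom_sum_mul_neg _ _
  have h6 : S = G * RA - (u • Mu) ^ (b + 1) * (G * RA) + S * E' := by
    calc S = S * ((1 - u • Mu) * (G * RA) + E') := by rw [h5, sub_add_cancel, Matrix.mul_one]
      _ = S * (1 - u • Mu) * (G * RA) + S * E' := by rw [Matrix.mul_add, Matrix.mul_assoc]
      _ = (1 - (u • Mu) ^ (b + 1)) * (G * RA) + S * E' := by rw [hgs]
      _ = G * RA - (u • Mu) ^ (b + 1) * (G * RA) + S * E' := by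
          rw [sub_mul 1 ((u • Mu) ^ (b + 1)) (G * RA), Matrix.one_mul]
  -- (6') compare the `u^b` coefficients of the `(i,j)` entries
  have hcoef : coeff (S i j) b = coeff ((G * RA - (u • Mu) ^ (b + 1) * (G * RA) + S * E') i j) b :=
    congrArg (fun Z : Matrix (Fin m) (Fin m) (Polynomial SRing) => coeff (Z i j) b) h6
  have hterm : ∀ a : ℕ, coeff (((u • Mu) ^ a) i j) b = if b = a then (M ^ a) i j else 0 := by
    intro a
    rw [smul_pow, Matrix.smul_apply, smul_eq_mul, hMu, ← Matrix.map_pow M (Polynomial.C : SRing →+* _) a]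
    change coeff (u ^ a * Polynomial.C ((M ^ a) i j)) b = _
    rw [mul_comm, hu, Polynomial.coeff_C_mul_X_pow]
  have hL : coeff (S i j) b = (M ^ b) i j := by
    rw [hS, Matrix.sum_apply, Polynomial.finsetSum_coeff,
      Finset.sum_eq_single_of_mem b (Finset.mem_range.2 (Nat.lt_succ_self b))
        (fun a _ hab => by rw [hterm a, if_neg (Ne.symm hab)]),
      hterm b, if_pos rfl]
  have hR2 : coeff (((u • Mu) ^ (b + 1) * (G * RA)) i j) b = 0 := by
    rw [smul_pow, Matrix.smul_mul, Matrix.smul_apply, smul_eq_mul, hu, Polynomial.coeff_X_pow_mul',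
      if_neg (by omega)]
  -- the new error term is a multiple of `u^{b+1}` as well
  have hR3 : coeff ((S * E') i j) b = 0 := by
    rw [hE', hE, smul_pow, mul_pow, mul_comm (σ ^ (b + 1)) (u ^ (b + 1)), mul_smul, Matrix.smul_mul,
      Matrix.mul_smul, Matrix.mul_smul, Matrix.smul_apply, smul_eq_mul, hu, Polynomial.coeff_X_pow_mul',
      if_neg (by omega)]
  have hR1 : coeff ((G * RA) i j) b = ∑ d ∈ Finset.range (b + 1),
      (if d ≤ b then (MvPolynomial.X 0 : SRing) ^ d *
        MvPolynomial.C (coeff (((twist N x v) ^ d * resolvent N x) i j) (b - d)) else 0) := by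
    rw [hG, Finset.sum_mul, Matrix.sum_apply, Polynomial.finsetSum_coeff]
    refine Finset.sum_congr rfl fun d _ => ?_
    rw [smul_pow, Matrix.smul_mul, Matrix.smul_apply, smul_eq_mul, hTdef, hRA, ← map_pow, ← map_mul,
      transport_apply, mul_pow, hσ, ← Polynomial.C_pow, mul_assoc, Polynomial.coeff_C_mul, hu,
      Polynomial.coeff_X_pow_mul']
    by_cases hdb : d ≤ b
    · rw [if_pos hdb, if_pos hdb, Polynomial.coeff_map]
    · rw [if_neg hdb, if_neg hdb, mul_zero]
  rw [hL, Matrix.add_apply, Matrix.sub_apply, Polynomial.coeff_add, Polynomial.coeff_sub, hR2, hR3,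
    sub_zero, add_zero, hR1] at hcoef
  rw [hcoef]
  exact Finset.sum_congr rfl fun d hd => if_pos (Nat.lt_succ_iff.1 (Finset.mem_range.1 hd))

/-- Monomials of the one-variable `s`-ring. -/
private theorem X_pow_mul_C_eq_monomial (d : ℕ) (c : ℂ) :
    (MvPolynomial.X 0 : SRing) ^ d * MvPolynomial.C c = MvPolynomial.monomial (Finsupp.single 0 d) c := by
  rw [MvPolynomial.X_pow_eq_monomial, MvPolynomial.C_apply, MvPolynomial.monomial_mul, add_zero, one_mul]

/-- **`s^d`-COEFFICIENT FORMULA** (exact dictionary, entrywise): `[s^d] (N(x+sv)^b)_{ij} = [u^{b−d}] (T^d · R_A)_{ij}` for `d ≤ b`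
(and `0` for `d > b`). -/
theorem coeff_pow_lineSubst_apply (N : AffMat n m) (hN : IsAffine N) (hnil : N ^ m = 0)
    (x v : Fin n × Fin n → ℂ) (b d : ℕ) (i j : Fin m) :
    MvPolynomial.coeff (Finsupp.single 0 d) (((N.map (lineSubst x v)) ^ b) i j) =
      if d ≤ b then coeff (((twist N x v) ^ d * resolvent N x) i j) (b - d) else 0 := by
  classical
  rw [pow_lineSubst_apply_eq_sum N hN hnil x v b i j, MvPolynomial.coeff_sum]
  simp_rw [X_pow_mul_C_eq_monomial, MvPolynomial.coeff_monomial, (Finsupp.single_injective (0 : Fin 1)).eq_iff]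
  simp only [Finset.sum_ite_eq', Finset.mem_range, Nat.lt_succ_iff]

/-- **LEDGER ⟺ ONE CONGRUENCE (the exact dictionary (D2) in kernel).**  `(K, k)` is a whole-pencil ledger of `N` iff at every
point `x`, for every `v ∈ K`, `(R_{N(x)}(u)·lin v)^{k+1} ≡ 0 mod u^{n−1−k}` — all `u`-coefficients of index `e ≤ n−2−k` of the
`(k+1)`-st power of the twist vanish.  (`⇐` is the certificate direction; `⇒` says the resolvent instrument loses nothing.) -/
theorem ledger_top_iff_twist_pow_congr (N : AffMat n m) (hN : IsAffine N) (hnil : N ^ m = 0)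
    (K : Submodule ℂ (Fin n × Fin n → ℂ)) (k : ℕ) :
    Ledger n m N (fun _ => True) K k ↔
      ∀ x v : Fin n × Fin n → ℂ, v ∈ K → ∀ i j : Fin m, ∀ e : ℕ, e + k + 2 ≤ n →
        coeff (((twist N x v) ^ (k + 1)) i j) e = 0 := by
  classical
  constructor
  · intro hL x v hv i j e he
    -- Step A: `T^{k+1}·R_A ≡ 0 mod u^{n−1−k}` from the `s^{k+1}`-coefficients of the powers `b = e' + k + 1 ≤ n − 1`
    have hA : ∀ (i' j' : Fin m) (e' : ℕ), e' + k + 2 ≤ n →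
        coeff (((twist N x v) ^ (k + 1) * resolvent N x) i' j') e' = 0 := by
      intro i' j' e' he'
      have hdeg := hL x v hv (e' + k + 1) (by omega) i' j' trivial trivial
      have hz : MvPolynomial.coeff (Finsupp.single 0 (k + 1)) (((N.map (lineSubst x v)) ^ (e' + k + 1)) i' j') = 0 :=
        MvPolynomial.coeff_eq_zero_of_totalDegree_lt (by
          rw [Finsupp.support_single _ (Nat.succ_ne_zero k), Finset.sum_singleton, Finsupp.single_eq_same]
          omega)
      rw [coeff_pow_lineSubst_apply N hN hnil x v (e' + k + 1) (k + 1) i' j', if_pos (by omega),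
        show e' + k + 1 - (k + 1) = e' by omega] at hz
      exact hz
    -- Step B: `T^{k+1} = (T^{k+1} R_A)(1 − uA)`
    have hTk : (twist N x v) ^ (k + 1) = ((twist N x v) ^ (k + 1) * resolvent N x) *
        (1 - (Polynomial.X : ℂ[X]) • (pointMat N x).map Polynomial.C) := by
      rw [Matrix.mul_assoc, resolvent_mul_one_sub_smul N hnil x, Matrix.mul_one]
    rw [hTk, Matrix.mul_sub, Matrix.mul_one, Matrix.mul_smul, Matrix.sub_apply, Matrix.smul_apply, smul_eq_mul,
      Polynomial.coeff_sub, hA i j e he, zero_sub, neg_eq_zero, ← pow_one (Polynomial.X : ℂ[X]),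
      Polynomial.coeff_X_pow_mul']
    by_cases he1 : 1 ≤ e
    · rw [if_pos he1, Matrix.mul_apply, Polynomial.finsetSum_coeff]
      refine Finset.sum_eq_zero fun l _ => ?_
      rw [Matrix.map_apply, Polynomial.coeff_mul_C, hA i l (e - 1) (by omega), zero_mul]
    · rw [if_neg he1]
  · intro hC x v hv b hb i j _ _
    rw [pow_lineSubst_apply_eq_sum N hN hnil x v b i j]
    refine (MvPolynomial.totalDegree_finsetSum _ _).trans (Finset.sup_le fun d hd => ?_)
    have hdb : d ≤ b := Nat.lt_succ_iff.1 (Finset.mem_range.1 hd)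
    by_cases hdk : d ≤ k
    · refine (MvPolynomial.totalDegree_mul _ _).trans ?_
      rw [MvPolynomial.totalDegree_C, add_zero]
      exact (MvPolynomial.totalDegree_X_pow (R := ℂ) (0 : Fin 1) d).le.trans hdk
    · -- `d ≥ k+1`: the coefficient `[u^{b−d}](T^d R_A)_{ij}` vanishes by the congruence
      have hz : coeff (((twist N x v) ^ d * resolvent N x) i j) (b - d) = 0 := by
        obtain ⟨d', rfl⟩ : ∃ d', d = (k + 1) + d' := ⟨d - (k + 1), by omega⟩
        rw [pow_add, Matrix.mul_assoc, Matrix.mul_apply, Polynomial.finsetSum_coeff]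
        refine Finset.sum_eq_zero fun l _ => ?_
        rw [Polynomial.coeff_mul]
        refine Finset.sum_eq_zero fun p hp => ?_
        have hp' := Finset.HasAntidiagonal.mem_antidiagonal.1 hp
        rw [hC x v hv i l p.1 (by omega), zero_mul]
      rw [hz, MvPolynomial.C_0, mul_zero, MvPolynomial.totalDegree_zero]
      exact Nat.zero_le _

/-- ✓ **Sharper pluggable form for (c)** (a CONGRUENCE certificate): if for all `x` and `v ∈ K` the `u`-coefficients of index
`≤ n−2−k` of `(R_{N(x)}(u)·lin v)^{k+1}` vanish, then `(K, k)` is a whole-pencil `RelCert` of price `n·k + codim K`. -/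
theorem relCert_of_twist_pow_congr (N : AffMat n m) (hN : IsAffine N) (hnil : N ^ m = 0)
    (K : Submodule ℂ (Fin n × Fin n → ℂ)) (k : ℕ)
    (hK : ∀ x v : Fin n × Fin n → ℂ, v ∈ K → ∀ i j : Fin m, ∀ e : ℕ, e + k + 2 ≤ n →
      coeff (((twist N x v) ^ (k + 1)) i j) e = 0) :
    RelCert n m N (n * k + (n * n - Module.finrank ℂ K)) :=
  ⟨K, k, (ledger_top_iff_twist_pow_congr N hN hnil K k).2 hK, le_rfl⟩

end Proof

end Summit.ValiantsHypothesis.ValiantsHypothesis.Cruxes.DualUnipotentThreeHalves.ResolventFlag
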